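import Literature.NumberTheory.Automorphic.Liu2021.Def411WeilCarriersAtChiSplittingTensor
import Literature.NumberTheory.Automorphic.UnitaryGroupCongrSymmSplitPlaceHeckeEigenvalues
import Literature.NumberTheory.Automorphic.UnitaryGroupDualPairLocalLine
import Literature.NumberTheory.Automorphic.RestrictedTensorProductRepTransport
import Literature.NumberTheory.Automorphic.WeilCoinvCenterRestrictedTensorAtLine
import HarnessLib

/-!
# [Liu2021, Lem. D.1 (2)/(4)] at a split place — the GLOBAL assembly for `ω(μ,ε,χ)` at the `θ`-splitting, read on `U(J⋆)` («S4c-G»)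

Topic `Literature/NumberTheory/Automorphic/Liu2021`; proof file (one theorem: no definition, no named fact, no instance); count-neutral.
For the Weil representation `ω⋆ = rhoVAtLine … a χ` of `U(diag dV₁)(𝔸_{F,f})` at THE `θ`-splitting ([Liu2021, Def. 4.11]) and a
rational frame `ᵗ(c g⋆)(t • J⋆) g⋆ = diag dV₁`, the representation `ω⋆ ∘ (finAdelicCongr g⋆)⁻¹` of `U(J⋆)(𝔸_{F,f})` satisfies, off a
finite set `S₁` of places of `F = L⁺` and at every `v ∉ S₁` split in `L` with `w ∣ v` (place conditions: `J⋆, diag dV₁` of good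
reduction at `w`, `g⋆⁻¹_w ∈ GL(𝒪_w)`, the local congruence matching the integral levels), for every level `K` hyperspecial at `v`:
**every LOCAL eigen-equation `[U(𝒪_v) e_w⁻¹(diag(ϖ^{(i)})) U(𝒪_v)] = c₀` on the `U(diag dV₁)(𝒪_v)`-fixed vectors of the place-`v`
factor — the local central `χ_v`-coinvariants `TwistedCoinv.rep (localCharOfCenter χ v) (𝓢_θ.omegaLoc v) _` of the `θ`-package
restricted along `localLineInl v : U(J_V)(F_v) → U(J_V ⊗ J_W)(F_v)` — is a GLOBAL one: `T_{w,i} x = c₀ • x` on `(ω⋆ ∘ congr⁻¹)^K`.**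

It is the composition BY NAME of the GENERIC junction `WeilCoinv.exists_isRestrictedTensorProductRep_comp_finAdelicEquiv_symm_of_equiv_omega_center`
(`WeilCoinvCenterRestrictedTensorAtLine`: ANY splitting family `𝓢`, ANY `ρ` with an intertwiner to the central `χ`-coinvariants of `Ω_𝓢` —
generalise-then-specialise, so that the `θ`-package is elaborated once) with `survival_atLine` and FILE A; the junction itself composes
`exists_isRestrictedTensorProductRep_omegaPi_center` (the `⊗'`
model of the global central coinvariants of the `θ`-package, survival set `S₁`), `IsRestrictedTensorProductRep.comp` along
`localLineInl` (`eventually_localLineInl_mapsTo_localInt`), `finAdelicEquiv_finPairEmb_inl_eq_mapAlong`,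
`Def411WeilCarriers.exists_equiv_rhoVAtLine_chiSplittingLine_omega_center` + `WeilCoinv.exists_equiv_omega_center_omegaPi_center`
(the two intertwiners `T`, `E′` from `ω⋆` to those coinvariants), `IsRestrictedTensorProductRep.comp_linearEquiv`, and
`UnitaryGroup.heckeTAt_comp_finAdelicCongr_symm_apply_eq_smul` (S4c-B′).  The d6 consumer supplies `c₀` from the local split-place
model (`splitPlace_heckeOperator_localInt_apply_localSplittingCM` ∘ the local undoubling bridge) and reads it as `μ_i(ϖ_w)`.

## References
* Y. Liu, Camb. J. Math. 9 (2021), Def. 4.11 (l. 2092–2096), App. D §D.1 Steps 1–3, Lemma D.1 (2),(4), p. 126. [Liu2021]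
* D. Flath, Corvallis 1979, part 1, §2 Example 2. [Flath1979]
* V. Platonov, A. Rapinchuk (1994), §5.1. [PlatonovRapinchuk1994]
-/

set_option autoImplicit false

noncomputable section

open scoped Matrix Kronecker TensorProduct Classical RestrictedProduct MatrixGroups
open NumberField NumberField.mixedEmbedding IsDedekindDomain Filter Set MulAction
open Literature.NumberTheory Literature.NumberTheory.Automorphic Literature.NumberTheory.Automorphic.UnitaryGroup
open Literature.NumberTheory.GelbartRogawski1991 Literature.NumberTheory.GelbartRogawski1991.UnitaryDualPair
open Literature.NumberTheory.GelbartRogawski1991.UnitaryDualPair.WeilCoinv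
open Literature.NumberTheory.GelbartRogawski1991.GRConstruction
open Literature.NumberTheory.Weil1964 Literature.RepresentationTheory
open Literature.RepresentationTheory.HeisenbergGroup
open Literature.NumberTheory.GaloisRepresentations Literature.RepresentationTheory.HarrisKudlaSweet1996
open Literature.NumberTheory.Automorphic.Liu2021.Def411WeilCarriersDoubling

namespace Literature.NumberTheory.Automorphic.Liu2021.Def411WeilCarriers

variable (L : Type) [Field L] [NumberField L] [IsCMField L]
variable {N' n' : ℕ} (e₁ : Fin N' × Fin 1 ≃ Fin n')
  (dV₁ : Fin N' → L) (hdV₁ : ∀ i, IsCMField.complexConj L (dV₁ i) = dV₁ i) (hdV₁0 : ∀ i, dV₁ i ≠ 0)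
  (θ : HeckeCharacter L) (hθu : θ.IsUnitary) (hθs : IsSplittingChar L 1 θ)
  (a : (Fp L)ˣ) (χ : Chi (Fp L) L (IsCMField.complexConj L))
  (𝔪 : ∀ v, PlaceMeasure L v)
  (𝓕 : FinLocalFamily L e₁ dV₁ hdV₁ hdV₁0 (lineW L (TW (Fp L) a)) (complexConj_lineW L (TW (Fp L) a))
    (lineW_ne_zero L (TW (Fp L) a) (isUnit_det_TW (Fp L) a)) θ 𝔪)

include hdV₁0 in
set_option maxHeartbeats 800000 in -- measured (A-p06 (g14) census): statement 315 k + proof task 219 k — the generic junction instantiated once at THE `θ`-package; ed.1 draft needed 20 000 000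
/-- **«S4c-H»: `ω⋆ ∘ finAdelicEquiv⁻¹` IS a restricted tensor product of the local central `χ_v`-coinvariants of the `θ`-package
restricted along `localLineInl v`** (off the survival set `S₁`): FILE B §3 (`⊗'` model of the global central coinvariants) pulled back
along `Πʳ localLineInl` (`IsRestrictedTensorProductRep.comp`, `finAdelicEquiv_finPairEmb_inl_eq_mapAlong`) and transported along the
intertwiners `T` (FILE A) and `E′` (FILE B §2) (`IsRestrictedTensorProductRep.comp_linearEquiv`).
[cite: Liu2021, Def. 4.11 (l. 2092–2096), App. D §D.1 Steps 1–3] [cite: Flath1979, §2 Example 2] -/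
theorem exists_isRestrictedTensorProductRep_rhoVAtLine_comp_finAdelicEquiv_symm [NeZero n'] :
    ∃ (S₁ : Finset (HeightOneSpectrum (𝓞 (Fp L))))
      (jW : RestrictedFamily _ _ → omegaAtLine (Fp L) L (IsCMField.complexConj L) N' e₁ (Matrix.diagonal dV₁) (complexConj_imagUnit L)
          (imagUnit_ne_zero L) (imagUnit_mul_self L) (realDiagonal_isSymm L dV₁ hdV₁) (isUnit_det_realDiagonal L dV₁ hdV₁ hdV₁0)
          (realDiagonal_map L dV₁ hdV₁).symm
          (fun b => isCompatible_chiSplittingLine L e₁ dV₁ hdV₁ hdV₁0 θ hθu hθs (TW (Fp L) b) (isSymm_TW (Fp L) b)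
            (isUnit_det_TW (Fp L) b) (JW (Fp L) L b) (JW_eq (Fp L) L b)) a χ),
      IsRestrictedTensorProductRep (K := fun v => localInt L (IsCMField.complexConj L) N' (Matrix.diagonal dV₁) v)
        (fun v => show Representation ℂ (localPi L (IsCMField.complexConj L) N' (Matrix.diagonal dV₁) v) _ from
          (TwistedCoinv.rep (localCharOfCenter (Fp L) L (IsCMField.complexConj L) (JW (Fp L) L a)
            (JW_apply_ne_zero (Fp L) L a) χ.1 v) ((congrW L e₁ dV₁ hdV₁ (lineW L (TW (Fp L) a)) (complexConj_lineW L (TW (Fp L) a)) (realDiagonal_lineW L (TW (Fp L) a))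
              (diagonal_lineW L (TW (Fp L) a) (JW_eq (Fp L) L a))
              (undoubledSplittings L e₁ dV₁ hdV₁ hdV₁0 (lineW L (TW (Fp L) a)) (complexConj_lineW L (TW (Fp L) a))
                (lineW_ne_zero L (TW (Fp L) a) (isUnit_det_TW (Fp L) a)) θ 𝔪 𝓕)
              (isSymm_TW (Fp L) a) (JW_eq (Fp L) L a)).omegaLoc v)
          (commute_omegaLoc_localCenter (Fp L) L (IsCMField.complexConj L) N' e₁ (Matrix.diagonal dV₁) (JW (Fp L) L a)
            (complexConj_imagUnit L) (imagUnit_ne_zero L) (imagUnit_mul_self L) (realDiagonal_isSymm L dV₁ hdV₁)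
            (isSymm_TW (Fp L) a) (realDiagonal_map L dV₁ hdV₁).symm (JW_eq (Fp L) L a) (JW_apply_ne_zero (Fp L) L a) (congrW L e₁ dV₁ hdV₁ (lineW L (TW (Fp L) a)) (complexConj_lineW L (TW (Fp L) a)) (realDiagonal_lineW L (TW (Fp L) a))
              (diagonal_lineW L (TW (Fp L) a) (JW_eq (Fp L) L a))
              (undoubledSplittings L e₁ dV₁ hdV₁ hdV₁0 (lineW L (TW (Fp L) a)) (complexConj_lineW L (TW (Fp L) a))
                (lineW_ne_zero L (TW (Fp L) a) (isUnit_det_TW (Fp L) a)) θ 𝔪 𝓕)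
              (isSymm_TW (Fp L) a) (JW_eq (Fp L) L a)) v)).comp
            (localLineInl L (IsCMField.complexConj L) N' e₁ (Matrix.diagonal dV₁) (JW (Fp L) L a) v))
        ((rhoVAtLine (Fp L) L (IsCMField.complexConj L) N' e₁ (Matrix.diagonal dV₁) (complexConj_imagUnit L)
            (imagUnit_ne_zero L) (imagUnit_mul_self L) (realDiagonal_isSymm L dV₁ hdV₁) (isUnit_det_realDiagonal L dV₁ hdV₁ hdV₁0)
            (realDiagonal_map L dV₁ hdV₁).symm
            (fun b => isCompatible_chiSplittingLine L e₁ dV₁ hdV₁ hdV₁0 θ hθu hθs (TW (Fp L) b) (isSymm_TW (Fp L) b)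
              (isUnit_det_TW (Fp L) b) (JW (Fp L) L b) (JW_eq (Fp L) L b)) a χ).comp
          (finAdelicEquiv (Fp L) L (IsCMField.complexConj L) N' (Matrix.diagonal dV₁)).symm.toMonoidHom)
        (Representation.eventually_mem_fixedPoints_comp (fun v => localLineInl L (IsCMField.complexConj L) N' e₁ (Matrix.diagonal dV₁) (JW (Fp L) L a) v)
          (IsRestrictedTensorProductRep.eventually_mk_mem_fixedPoints
          (commute_omegaLoc_localCenter (Fp L) L (IsCMField.complexConj L) N' e₁ (Matrix.diagonal dV₁) (JW (Fp L) L a)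
            (complexConj_imagUnit L) (imagUnit_ne_zero L) (imagUnit_mul_self L) (realDiagonal_isSymm L dV₁ hdV₁)
            (isSymm_TW (Fp L) a) (realDiagonal_map L dV₁ hdV₁).symm (JW_eq (Fp L) L a) (JW_apply_ne_zero (Fp L) L a) (congrW L e₁ dV₁ hdV₁ (lineW L (TW (Fp L) a)) (complexConj_lineW L (TW (Fp L) a)) (realDiagonal_lineW L (TW (Fp L) a))
              (diagonal_lineW L (TW (Fp L) a) (JW_eq (Fp L) L a))
              (undoubledSplittings L e₁ dV₁ hdV₁ hdV₁0 (lineW L (TW (Fp L) a)) (complexConj_lineW L (TW (Fp L) a))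
                (lineW_ne_zero L (TW (Fp L) a) (isUnit_det_TW (Fp L) a)) θ 𝔪 𝓕)
              (isSymm_TW (Fp L) a) (JW_eq (Fp L) L a)))
          (congrW L e₁ dV₁ hdV₁ (lineW L (TW (Fp L) a)) (complexConj_lineW L (TW (Fp L) a)) (realDiagonal_lineW L (TW (Fp L) a))
              (diagonal_lineW L (TW (Fp L) a) (JW_eq (Fp L) L a))
              (undoubledSplittings L e₁ dV₁ hdV₁ hdV₁0 (lineW L (TW (Fp L) a)) (complexConj_lineW L (TW (Fp L) a))
                (lineW_ne_zero L (TW (Fp L) a) (isUnit_det_TW (Fp L) a)) θ 𝔪 𝓕)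
              (isSymm_TW (Fp L) a) (JW_eq (Fp L) L a)).unitVec_mem_fixedPoints)
          (eventually_localLineInl_mapsTo_localInt L (IsCMField.complexConj L) N' e₁ (Matrix.diagonal dV₁) (JW (Fp L) L a)))
        jW S₁ :=
  -- generalise-then-specialise: the generic junction ★ `exists_isRestrictedTensorProductRep_comp_finAdelicEquiv_symm_of_equiv_omega_center`
  -- (ANY splitting family `𝓢`, ANY `ρ` with an intertwiner `T` to the central `χ`-coinvariants of `Ω_𝓢`) at THE `θ`-package, with
  -- `T` from FILE A ★ `exists_equiv_rhoVAtLine_chiSplittingLine_omega_center` and the survival set of ★ `survival_atLine`; the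
  -- `θ`-package is spelled ONCE (in `survival_atLine`) and every ∃ is consumed as a term
  (survival_atLine (Fp L) L (IsCMField.complexConj L) N' e₁ (Matrix.diagonal dV₁) (complexConj_imagUnit L)
    (imagUnit_ne_zero L) (imagUnit_mul_self L) (realDiagonal_isSymm L dV₁ hdV₁) (isUnit_det_realDiagonal L dV₁ hdV₁ hdV₁0)
    (realDiagonal_map L dV₁ hdV₁).symm a χ
    (congrW L e₁ dV₁ hdV₁ (lineW L (TW (Fp L) a)) (complexConj_lineW L (TW (Fp L) a)) (realDiagonal_lineW L (TW (Fp L) a))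
      (diagonal_lineW L (TW (Fp L) a) (JW_eq (Fp L) L a))
      (undoubledSplittings L e₁ dV₁ hdV₁ hdV₁0 (lineW L (TW (Fp L) a)) (complexConj_lineW L (TW (Fp L) a))
        (lineW_ne_zero L (TW (Fp L) a) (isUnit_det_TW (Fp L) a)) θ 𝔪 𝓕)
      (isSymm_TW (Fp L) a) (JW_eq (Fp L) L a))).elim fun S₁ hS₁ =>
  (exists_equiv_rhoVAtLine_chiSplittingLine_omega_center L e₁ dV₁ hdV₁ hdV₁0 θ hθu hθs a χ 𝔪 𝓕).elim fun T hT =>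
  (exists_isRestrictedTensorProductRep_comp_finAdelicEquiv_symm_of_equiv_omega_center (Fp L) L (IsCMField.complexConj L) N' e₁
    (Matrix.diagonal dV₁) (JW (Fp L) L a) (complexConj_imagUnit L) (imagUnit_ne_zero L) (imagUnit_mul_self L)
    (realDiagonal_isSymm L dV₁ hdV₁) (isSymm_TW (Fp L) a) (realDiagonal_map L dV₁ hdV₁).symm (JW_eq (Fp L) L a)
    (JW_apply_ne_zero (Fp L) L a) _ χ.2.1 hS₁ _ T hT.2).elim fun jW h => ⟨S₁, jW, h⟩

include hdV₁0 in
set_option maxHeartbeats 800000 in -- measured (A-p06 (g14) census): statement 73 k + proof task 463 k — one application of S4c-B′ under the 17 binders; ed.1 draft needed 8 000 000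
/-- **«S4c-G» — [Liu2021, Lem. D.1 (2),(4)] at a split place, global form for `ω⋆ ∘ (finAdelicCongr g⋆)⁻¹` on `U(J⋆)`.**  Off the
survival set `S₁` of the `θ`-package: at every `v ∉ S₁` with `w ∣ v` split, under the place conditions (`hJw`, `hJ′w`, `hJ′i`, `hBw`,
`hKv`) and for every level `K ≤ U(J⋆)(𝔸_f)` hyperspecial at `v`, a local eigen-equation (`hloc`, eigenvalue `c₀`) for the `v`-factor
`TwistedCoinv.rep (localCharOfCenter χ v) (𝓢_θ.omegaLoc v) _ ∘ localLineInl v` gives `heckeTAt … (ω⋆ ∘ congr⁻¹) K w … ϖ i x = c₀ • x` for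
every `K`-fixed `x`. [cite: Liu2021, Def. 4.11 (l. 2092–2096), App. D §D.1 Steps 1–3, Lemma D.1 (2),(4), p. 126] [cite: Flath1979, §2 Example 2]
[cite: PlatonovRapinchuk1994, §5.1] -/
theorem rhoVAtLine_congr_heckeTAt_apply_eq_smul [NeZero n']
    (Jstar : Matrix (Fin N') (Fin N') L) (t : L) (ht : t ≠ 0) (gstar : GL (Fin N') L)
    (hg : formCongr ((IsCMField.complexConj L : L ≃ₐ[Fp L] L) : L →+* L) gstar (t • Jstar) = Matrix.diagonal dV₁)
    (hJ : (Jstar.map (IsCMField.complexConj L))ᵀ = Jstar)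
    (hJ' : ((Matrix.diagonal dV₁).map (IsCMField.complexConj L))ᵀ = Matrix.diagonal dV₁) :
    ∃ S₁ : Finset (HeightOneSpectrum (𝓞 (Fp L))),
      ∀ (v : HeightOneSpectrum (𝓞 (Fp L))), v ∉ S₁ →
      ∀ (w : UnitaryGroup.PlacesOver L v) (hw : IsCMField.complexConj L • w.1 ≠ w.1)
        (hJw : IsUnit (placeForm Jstar w.1)) (hJ'w : IsUnit (placeForm (Matrix.diagonal dV₁) w.1))
        (_hJ'i : hJ'w.unit ∈ glInt N' (w.1.adicCompletion L))
        (_hBw : Matrix.GeneralLinearGroup.map (algebraMap L (w.1.adicCompletion L)) gstar⁻¹ ∈ glInt N' (w.1.adicCompletion L))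
        (_hKv : ∀ u : localPi L (IsCMField.complexConj L) N' Jstar v,
          localCongr L (IsCMField.complexConj L) gstar⁻¹ (inv_ne_zero ht)
              (formCongr_inv_smul_of_formCongr gstar ht hg) v u ∈ localInt L (IsCMField.complexConj L) N' (Matrix.diagonal dV₁) v ↔
            u ∈ localInt L (IsCMField.complexConj L) N' Jstar v)
        (K : Subgroup (finAdelic (Fp L) L (IsCMField.complexConj L) N' Jstar))
        (_hK : IsHyperspecialAt (Fp L) L (IsCMField.complexConj L) N' Jstar K v)
        (ϖ : (w.1.adicCompletion L)ˣ) (i : ℕ) (c₀ : ℂ)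
        (_hloc : ∀ y ∈ Representation.fixedPoints
            (show Representation ℂ (localPi L (IsCMField.complexConj L) N' (Matrix.diagonal dV₁) v) _ from
          (TwistedCoinv.rep (localCharOfCenter (Fp L) L (IsCMField.complexConj L) (JW (Fp L) L a)
            (JW_apply_ne_zero (Fp L) L a) χ.1 v) ((congrW L e₁ dV₁ hdV₁ (lineW L (TW (Fp L) a)) (complexConj_lineW L (TW (Fp L) a)) (realDiagonal_lineW L (TW (Fp L) a))
              (diagonal_lineW L (TW (Fp L) a) (JW_eq (Fp L) L a))
              (undoubledSplittings L e₁ dV₁ hdV₁ hdV₁0 (lineW L (TW (Fp L) a)) (complexConj_lineW L (TW (Fp L) a))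
                (lineW_ne_zero L (TW (Fp L) a) (isUnit_det_TW (Fp L) a)) θ 𝔪 𝓕)
              (isSymm_TW (Fp L) a) (JW_eq (Fp L) L a)).omegaLoc v)
          (commute_omegaLoc_localCenter (Fp L) L (IsCMField.complexConj L) N' e₁ (Matrix.diagonal dV₁) (JW (Fp L) L a)
            (complexConj_imagUnit L) (imagUnit_ne_zero L) (imagUnit_mul_self L) (realDiagonal_isSymm L dV₁ hdV₁)
            (isSymm_TW (Fp L) a) (realDiagonal_map L dV₁ hdV₁).symm (JW_eq (Fp L) L a) (JW_apply_ne_zero (Fp L) L a) (congrW L e₁ dV₁ hdV₁ (lineW L (TW (Fp L) a)) (complexConj_lineW L (TW (Fp L) a)) (realDiagonal_lineW L (TW (Fp L) a))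
              (diagonal_lineW L (TW (Fp L) a) (JW_eq (Fp L) L a))
              (undoubledSplittings L e₁ dV₁ hdV₁ hdV₁0 (lineW L (TW (Fp L) a)) (complexConj_lineW L (TW (Fp L) a))
                (lineW_ne_zero L (TW (Fp L) a) (isUnit_det_TW (Fp L) a)) θ 𝔪 𝓕)
              (isSymm_TW (Fp L) a) (JW_eq (Fp L) L a)) v)).comp
            (localLineInl L (IsCMField.complexConj L) N' e₁ (Matrix.diagonal dV₁) (JW (Fp L) L a) v))
            (localInt L (IsCMField.complexConj L) N' (Matrix.diagonal dV₁) v),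
          heckeOperator
            (show Representation ℂ (localPi L (IsCMField.complexConj L) N' (Matrix.diagonal dV₁) v) _ from
          (TwistedCoinv.rep (localCharOfCenter (Fp L) L (IsCMField.complexConj L) (JW (Fp L) L a)
            (JW_apply_ne_zero (Fp L) L a) χ.1 v) ((congrW L e₁ dV₁ hdV₁ (lineW L (TW (Fp L) a)) (complexConj_lineW L (TW (Fp L) a)) (realDiagonal_lineW L (TW (Fp L) a))
              (diagonal_lineW L (TW (Fp L) a) (JW_eq (Fp L) L a))
              (undoubledSplittings L e₁ dV₁ hdV₁ hdV₁0 (lineW L (TW (Fp L) a)) (complexConj_lineW L (TW (Fp L) a))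
                (lineW_ne_zero L (TW (Fp L) a) (isUnit_det_TW (Fp L) a)) θ 𝔪 𝓕)
              (isSymm_TW (Fp L) a) (JW_eq (Fp L) L a)).omegaLoc v)
          (commute_omegaLoc_localCenter (Fp L) L (IsCMField.complexConj L) N' e₁ (Matrix.diagonal dV₁) (JW (Fp L) L a)
            (complexConj_imagUnit L) (imagUnit_ne_zero L) (imagUnit_mul_self L) (realDiagonal_isSymm L dV₁ hdV₁)
            (isSymm_TW (Fp L) a) (realDiagonal_map L dV₁ hdV₁).symm (JW_eq (Fp L) L a) (JW_apply_ne_zero (Fp L) L a) (congrW L e₁ dV₁ hdV₁ (lineW L (TW (Fp L) a)) (complexConj_lineW L (TW (Fp L) a)) (realDiagonal_lineW L (TW (Fp L) a))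
              (diagonal_lineW L (TW (Fp L) a) (JW_eq (Fp L) L a))
              (undoubledSplittings L e₁ dV₁ hdV₁ hdV₁0 (lineW L (TW (Fp L) a)) (complexConj_lineW L (TW (Fp L) a))
                (lineW_ne_zero L (TW (Fp L) a) (isUnit_det_TW (Fp L) a)) θ 𝔪 𝓕)
              (isSymm_TW (Fp L) a) (JW_eq (Fp L) L a)) v)).comp
            (localLineInl L (IsCMField.complexConj L) N' e₁ (Matrix.diagonal dV₁) (JW (Fp L) L a) v))
            (localInt L (IsCMField.complexConj L) N' (Matrix.diagonal dV₁) v)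
            ((localPiSplitEquiv (IsCMField.complexConj L) (Matrix.diagonal dV₁) (IsCMField.complexConj_ne_one L) hJ' w hw hJ'w).symm
              (heckeDiag N' ϖ i)) y = c₀ • y)
        (x : _) (_hx : x ∈ Representation.fixedPoints
          ((rhoVAtLine (Fp L) L (IsCMField.complexConj L) N' e₁ (Matrix.diagonal dV₁) (complexConj_imagUnit L)
            (imagUnit_ne_zero L) (imagUnit_mul_self L) (realDiagonal_isSymm L dV₁ hdV₁) (isUnit_det_realDiagonal L dV₁ hdV₁ hdV₁0)
            (realDiagonal_map L dV₁ hdV₁).symm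
            (fun b => isCompatible_chiSplittingLine L e₁ dV₁ hdV₁ hdV₁0 θ hθu hθs (TW (Fp L) b) (isSymm_TW (Fp L) b)
              (isUnit_det_TW (Fp L) b) (JW (Fp L) L b) (JW_eq (Fp L) L b)) a χ).comp
            (finAdelicCongr (Fp L) L (IsCMField.complexConj L) gstar ht hg).symm.toMonoidHom) K),
        UnitaryGroup.heckeTAt (Fp L) L (IsCMField.complexConj L) N' Jstar
          ((rhoVAtLine (Fp L) L (IsCMField.complexConj L) N' e₁ (Matrix.diagonal dV₁) (complexConj_imagUnit L)
            (imagUnit_ne_zero L) (imagUnit_mul_self L) (realDiagonal_isSymm L dV₁ hdV₁) (isUnit_det_realDiagonal L dV₁ hdV₁ hdV₁0)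
            (realDiagonal_map L dV₁ hdV₁).symm
            (fun b => isCompatible_chiSplittingLine L e₁ dV₁ hdV₁ hdV₁0 θ hθu hθs (TW (Fp L) b) (isSymm_TW (Fp L) b)
              (isUnit_det_TW (Fp L) b) (JW (Fp L) L b) (JW_eq (Fp L) L b)) a χ).comp
            (finAdelicCongr (Fp L) L (IsCMField.complexConj L) gstar ht hg).symm.toMonoidHom)
          K w (IsCMField.complexConj_ne_one L) hJ hw hJw ϖ i x = c₀ • x :=
  (exists_isRestrictedTensorProductRep_rhoVAtLine_comp_finAdelicEquiv_symm L e₁ dV₁ hdV₁ hdV₁0 θ hθu hθs a χ 𝔪 𝓕).elim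
    fun S₁ h => h.elim fun _ hρ => ⟨S₁, fun _ _ w hw hJw hJ'w hJ'i hBw hKv _ hK ϖ i c₀ hloc _ hx =>
      heckeTAt_comp_finAdelicCongr_symm_apply_eq_smul gstar w (IsCMField.complexConj_ne_one L) hJ hJ' hw hJw hJ'w ht hg _ hρ
        hKv hJ'i hBw hK ϖ i c₀ hloc hx⟩

end Literature.NumberTheory.Automorphic.Liu2021.Def411WeilCarriers

end
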